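import Literature.Geometry.Riemannian.LinearHeatCauchyExistence
import HarnessLib

/-!
# The heat equation of a smooth family of metrics on a closed manifold: smooth solutions on
# `M × [s, t]` — existence, maximum principle, sup-norm contraction, uniqueness
# (Friedman 1964, Ch. 3 Thm. 7; Topping 2006, Thm. 3.1.1; Bamler 2020a, §2)

For a family `h(r)` of Riemannian metrics on a closed manifold `M` (modelled on `ℝᵐ`), `C^∞` on
`M × ℝ`, the **heat equation of the family** is `∂ᵣ w = Δ_{h(r)} w` (for a Ricci flow `h` this is
the heat equation coupled to the flow of R. Bamler, *Entropy and heat kernel bounds on a Ricci flow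
background*, arXiv:2008.07093, §2, whose fundamental solution is the heat kernel). The tree solves
the Cauchy problem from time `0` (`exists_linearHeat_Icc`, Friedman 1964, Ch. 3, Thm. 7) and has
the sup bound / uniqueness on `[0, T]` (`linearHeat_le_mul_exp`, `linearHeat_abs_sub_le_mul_exp`,
`linearHeat_unique`, Topping 2006, Thm. 3.1.1). This file packages the notion of a smooth solution
on a general time interval `[s, t]` and transports those theorems by time translation:

* `IsHeatSolutionOn h w s t` — `w` is `C^∞` on `M × [s, t]` and `∂ᵣ w = Δ_{h(r)} w` there
  (one-sided time derivatives within `[s, t]`); closure under time translation, restriction, sums,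
  scalar multiples, constants (`laplaceBeltrami_const_fun`: `Δ c = 0`);
* `exists_isHeatSolutionOn` — existence from smooth data at time `s < t`;
* `IsHeatSolutionOn.le_of_le`, `.abs_sub_le`, `.unique`, `.le_of_le_initial` — sup bound,
  sup-norm contraction, uniqueness, comparison.

This is the solution-operator input of the heat propagation `P_{s→t}` and of the heat kernel
measures `ν_{x,t;s}` (`HeatPropagation.lean`, `HeatKernelMeasures.lean`; Bamler 2023, §3.7).
Everything is proved; the only definition is the predicate `IsHeatSolutionOn`; no named facts.

## References

* A. Friedman, *Partial differential equations of parabolic type*, Prentice-Hall 1964, Ch. 3,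
  Thm. 7 (Cauchy problem); Ch. 2, Thm. 1 (maximum principle). [Friedman1964]
* P. Topping, *Lectures on the Ricci flow*, LMS Lecture Note Series 325, CUP 2006, Thm. 3.1.1
  (weak maximum principle on closed manifolds). [Topping2006]
* R. H. Bamler, *Entropy and heat kernel bounds on a Ricci flow background*, arXiv:2008.07093
  (2020), §2 (heat operator `□ = ∂ₜ − Δ` coupled to a Ricci flow). [Bamler2020Entropy]
* B. O'Neill, *Semi-Riemannian geometry*, Academic Press 1983, Ch. 3, Defs. 3.48–3.50. [ONeill1983]
-/

noncomputable section

open Bundle Set Function Filter Manifold MeasureTheory Measure TopologicalSpace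
open scoped Manifold ContDiff Topology ENNReal

namespace Literature.Geometry.Riemannian

open Lorentzian Lorentzian.PseudoRiemannianMetric

/-! ### The Laplacian of a constant vanishes (local copies, cf. `QCurvatureFour.lean`) -/

section Const

variable {E : Type*} [NormedAddCommGroup E] [NormedSpace ℝ E] {H : Type*} [TopologicalSpace H]
  {I : ModelWithCorners ℝ E H} {M : Type*} [TopologicalSpace M] [ChartedSpace H M]
  [IsManifold I ∞ M] {n : ℕ∞ω} [Fact (1 ≤ n)] [FiniteDimensional ℝ E]
  (g : PseudoRiemannianMetric I n E (TangentSpace I : M → Type _)) [g.HasLeviCivita]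

omit [IsManifold I ∞ M] [Fact (1 ≤ n)] [FiniteDimensional ℝ E] [g.HasLeviCivita] in
/-- The differential of a constant function vanishes. [folklore] -/
private theorem mvfderiv_const_aux' (c : ℝ) (x : M) : mvfderiv I (fun _ : M ↦ c) x = 0 := by
  have h0 : mfderiv I 𝓘(ℝ, ℝ) (fun _ : M ↦ c) x = 0 := mfderiv_const
  ext v
  simp [mvfderiv, h0]

omit [Fact (1 ≤ n)] [FiniteDimensional ℝ E] in
/-- The bare Hessian operation of a constant vanishes (O'Neill 1983, Ch. 3, Def. 3.48).
[cite: ONeill1983, Ch. 3, Def. 3.48] -/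
private theorem hessianAux_const_aux' (c : ℝ) (X Y : Π x : M, TangentSpace I x) (x : M) :
    g.hessianAux (fun _ : M ↦ c) X Y x = 0 := by
  have h1 : (fun y ↦ mvfderiv I (fun _ : M ↦ c) y (Y y)) = fun _ ↦ (0 : ℝ) := by
    funext y
    rw [mvfderiv_const_aux' c y]
    rfl
  rw [PseudoRiemannianMetric.hessianAux, h1, mvfderiv_const_aux' (0 : ℝ) x, mvfderiv_const_aux' c x]
  simp

omit [Fact (1 ≤ n)] [FiniteDimensional ℝ E] in
/-- The Hessian of a constant function vanishes (O'Neill 1983, Ch. 3, Def. 3.48).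
[cite: ONeill1983, Ch. 3, Def. 3.48] -/
private theorem hessian_const_aux' (c : ℝ) (x : M) : g.hessian (fun _ : M ↦ c) x = 0 := by
  have haux : ∀ X Y : Π x : M, TangentSpace I x, g.hessianAux (fun _ : M ↦ c) X Y x = 0 :=
    fun X Y ↦ hessianAux_const_aux' g c X Y x
  unfold PseudoRiemannianMetric.hessian
  have hex : ∃ B : LinearMap.BilinForm ℝ (TangentSpace I x), ∀ X₀ Y₀ : TangentSpace I x,
      B X₀ Y₀ = g.hessianAux (fun _ : M ↦ c) (FiberBundle.extend E X₀) (FiberBundle.extend E Y₀) x :=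
    ⟨0, fun _ _ ↦ by simp [haux]⟩
  rw [dif_pos hex]
  ext X₀ Y₀
  simpa [haux] using hex.choose_spec X₀ Y₀

end Const

/-! ### Smooth solutions of the heat equation of a family of metrics on `M × [s, t]` -/

section Solutions

variable {m : ℕ} {H : Type*} [TopologicalSpace H]
  {I : ModelWithCorners ℝ (EuclideanSpace ℝ (Fin m)) H} [I.Boundaryless]
  {M : Type*} [TopologicalSpace M] [ChartedSpace H M] [IsManifold I ∞ M]
  [T2Space M] [CompactSpace M] [SecondCountableTopology M] [MeasurableSpace M] [BorelSpace M]
  {h : ℝ → PseudoRiemannianMetric I ∞ (EuclideanSpace ℝ (Fin m)) (TangentSpace I : M → Type _)}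

omit [I.Boundaryless] [T2Space M] [CompactSpace M] [SecondCountableTopology M]
  [MeasurableSpace M] [BorelSpace M] in
/-- **The Laplace–Beltrami operator kills constants**, `Δ_g c = 0` (O'Neill 1983, Ch. 3,
Def. 3.50). [cite: ONeill1983, Ch. 3, Def. 3.50] -/
theorem laplaceBeltrami_const_fun
    (g : PseudoRiemannianMetric I ∞ (EuclideanSpace ℝ (Fin m)) (TangentSpace I : M → Type _))
    (c : ℝ) (x : M) : g.laplaceBeltrami (fun _ : M ↦ c) x = 0 := by
  haveI := g.hasLeviCivita
  rw [laplaceBeltrami_eq_dalembertian]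
  simp [PseudoRiemannianMetric.dalembertian, hessian_const_aux' g c x, PseudoRiemannianMetric.trace]

/-- `w` is a **smooth solution of the heat equation `∂ᵣ w = Δ_{h(r)} w` of the family `h` on
`M × [s, t]`**: `(x, r) ↦ w r x` is `C^∞` on `M × [s, t]` and, at every `r ∈ [s, t]` and `x`, the
time derivative within `[s, t]` is `Δ_{h(r)} (w r) x` (Bamler 2020a, §2, the heat operator
`□ = ∂ₜ − Δ_{g_t}`). [cite: Bamler2020Entropy, §2] -/
def IsHeatSolutionOn
    (h : ℝ → PseudoRiemannianMetric I ∞ (EuclideanSpace ℝ (Fin m)) (TangentSpace I : M → Type _))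
    (w : ℝ → M → ℝ) (s t : ℝ) : Prop :=
  ContMDiffOn (I.prod 𝓘(ℝ, ℝ)) 𝓘(ℝ, ℝ) ∞ (fun p : M × ℝ ↦ w p.2 p.1) (univ ×ˢ Icc s t) ∧
    ∀ r ∈ Icc s t, ∀ x : M,
      HasDerivWithinAt (fun r' ↦ w r' x) ((h r).laplaceBeltrami (w r) x) (Icc s t) r

omit [I.Boundaryless] [T2Space M] [CompactSpace M] [SecondCountableTopology M]
  [MeasurableSpace M] [BorelSpace M] in
/-- Time translation of heat solutions: `r ↦ w (r + c)` solves the heat equation of the family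
`r ↦ h (r + c)` on `[s − c, t − c]`. [folklore] -/
theorem IsHeatSolutionOn.comp_add_const {w : ℝ → M → ℝ} {s t : ℝ}
    (hw : IsHeatSolutionOn h w s t) (c : ℝ) :
    IsHeatSolutionOn (fun r ↦ h (r + c)) (fun r ↦ w (r + c)) (s - c) (t - c) := by
  refine ⟨?_, ?_⟩
  · have hφ : ContMDiff (I.prod 𝓘(ℝ, ℝ)) (I.prod 𝓘(ℝ, ℝ)) ∞ (fun p : M × ℝ ↦ (p.1, p.2 + c)) :=
      contMDiff_fst.prodMk (contMDiff_snd.add contMDiff_const)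
    refine hw.1.comp hφ.contMDiffOn ?_
    rintro ⟨x, r⟩ ⟨-, hr⟩
    exact ⟨mem_univ _, by linarith [hr.1], by linarith [hr.2]⟩
  · intro r hr x
    have hr' : r + c ∈ Icc s t := ⟨by linarith [hr.1], by linarith [hr.2]⟩
    have h1 := hw.2 (r + c) hr' x
    have h2 : HasDerivWithinAt (fun r' : ℝ ↦ r' + c) 1 (Icc (s - c) (t - c)) r :=
      (hasDerivWithinAt_id r _).add_const c
    have hmaps : MapsTo (fun r' : ℝ ↦ r' + c) (Icc (s - c) (t - c)) (Icc s t) :=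
      fun r' hr' ↦ ⟨by linarith [hr'.1], by linarith [hr'.2]⟩
    have h3 := h1.comp r h2 hmaps
    simpa [Function.comp_def] using h3

omit [I.Boundaryless] [T2Space M] [CompactSpace M] [SecondCountableTopology M]
  [MeasurableSpace M] [BorelSpace M] in
/-- Restriction of a heat solution to a smaller time interval. [folklore] -/
theorem IsHeatSolutionOn.mono {w : ℝ → M → ℝ} {s t s' t' : ℝ}
    (hw : IsHeatSolutionOn h w s t) (hs : s ≤ s') (ht : t' ≤ t) :
    IsHeatSolutionOn h w s' t' := by
  refine ⟨hw.1.mono (prod_mono le_rfl (Icc_subset_Icc hs ht)), fun r hr x ↦ ?_⟩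
  exact (hw.2 r ⟨hs.trans hr.1, hr.2.trans ht⟩ x).mono (Icc_subset_Icc hs ht)

omit [I.Boundaryless] [T2Space M] [CompactSpace M] [SecondCountableTopology M]
  [MeasurableSpace M] [BorelSpace M] in
/-- Time slices of a heat solution are smooth. [folklore] -/
theorem IsHeatSolutionOn.contMDiff_slice {w : ℝ → M → ℝ} {s t : ℝ}
    (hw : IsHeatSolutionOn h w s t) {r : ℝ} (hr : r ∈ Icc s t) : ContMDiff I 𝓘(ℝ, ℝ) ∞ (w r) :=
  contMDiff_slice_of_contMDiffOn hw.1 hr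

omit [T2Space M] [CompactSpace M] [SecondCountableTopology M]
  [MeasurableSpace M] [BorelSpace M] in
/-- Sums of heat solutions are heat solutions (`laplaceBeltrami_fun_add`). [folklore] -/
theorem IsHeatSolutionOn.add {w₁ w₂ : ℝ → M → ℝ} {s t : ℝ}
    (hw₁ : IsHeatSolutionOn h w₁ s t) (hw₂ : IsHeatSolutionOn h w₂ s t) :
    IsHeatSolutionOn h (fun r y ↦ w₁ r y + w₂ r y) s t := by
  have h2 : (2 : ℕ∞ω) ≤ ((⊤ : ℕ∞) : ℕ∞ω) := WithTop.coe_le_coe.mpr le_top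
  refine ⟨hw₁.1.add hw₂.1, fun r hr x ↦ ?_⟩
  have hc₁ : ContMDiffAt I 𝓘(ℝ, ℝ) 2 (w₁ r) x := ((hw₁.contMDiff_slice hr).of_le h2).contMDiffAt
  have hc₂ : ContMDiffAt I 𝓘(ℝ, ℝ) 2 (w₂ r) x := ((hw₂.contMDiff_slice hr).of_le h2).contMDiffAt
  have e := laplaceBeltrami_fun_add (h r) hc₁ hc₂
  have key := (hw₁.2 r hr x).add (hw₂.2 r hr x)
  rw [← e] at key
  exact key

omit [T2Space M] [CompactSpace M] [SecondCountableTopology M]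
  [MeasurableSpace M] [BorelSpace M] in
/-- Constant multiples of heat solutions are heat solutions (`laplaceBeltrami_const_mul`).
[folklore] -/
theorem IsHeatSolutionOn.const_mul {w : ℝ → M → ℝ} {s t : ℝ}
    (hw : IsHeatSolutionOn h w s t) (c : ℝ) :
    IsHeatSolutionOn h (fun r y ↦ c * w r y) s t := by
  have h2 : (2 : ℕ∞ω) ≤ ((⊤ : ℕ∞) : ℕ∞ω) := WithTop.coe_le_coe.mpr le_top
  refine ⟨contMDiffOn_const.mul hw.1, fun r hr x ↦ ?_⟩
  have hc : ContMDiffAt I 𝓘(ℝ, ℝ) 2 (w r) x := ((hw.contMDiff_slice hr).of_le h2).contMDiffAt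
  have e := laplaceBeltrami_const_mul (h r) hc c
  have key := (hw.2 r hr x).const_mul c
  rw [← e] at key
  exact key

omit [I.Boundaryless] [T2Space M] [CompactSpace M] [SecondCountableTopology M]
  [MeasurableSpace M] [BorelSpace M] in
/-- Constants are heat solutions (`Δ c = 0`). [folklore] -/
theorem isHeatSolutionOn_const (c s t : ℝ) : IsHeatSolutionOn h (fun _ _ ↦ c) s t := by
  refine ⟨contMDiffOn_const, fun r _ x ↦ ?_⟩
  show HasDerivWithinAt (fun _ : ℝ ↦ c) ((h r).laplaceBeltrami (fun _ : M ↦ c) x) (Icc s t) r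
  rw [laplaceBeltrami_const_fun (h r) c x]
  exact hasDerivWithinAt_const _ _ _

variable (hh : IsContMDiffFamilyOn ∞ h univ) (hR : ∀ r, (h r).IsRiemannian)

include hh hR in
/-- **Existence of smooth solutions of the heat equation of the family `h` on `M × [s, t]` from
smooth data at time `s`** (`exists_linearHeat_Icc` — Friedman 1964, Ch. 3, Thm. 7 — for the
translated family `r ↦ h (r + s)` and the potential `Q = 0`, translated back).
[cite: Friedman1964, Ch. 3, Thm. 7] -/
theorem exists_isHeatSolutionOn {s t : ℝ} (hst : s < t) {φ : M → ℝ}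
    (hφ : ContMDiff I 𝓘(ℝ, ℝ) ∞ φ) :
    ∃ w : ℝ → M → ℝ, IsHeatSolutionOn h w s t ∧ w s = φ := by
  have hh' : IsContMDiffFamilyOn ∞ (fun r ↦ h (r + s)) univ := by
    simpa using hh.comp_add_const s
  have hR' : ∀ r, (h (r + s)).IsRiemannian := fun r ↦ hR _
  have hQ : ContMDiff (I.prod 𝓘(ℝ, ℝ)) 𝓘(ℝ, ℝ) ∞
      fun p : M × ℝ ↦ (fun (_ : ℝ) (_ : M) ↦ (0 : ℝ)) p.2 p.1 :=
    contMDiff_const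
  obtain ⟨w', hw', hw'0, hw'eq⟩ := exists_linearHeat_Icc (h := fun r ↦ h (r + s)) hh' hR'
    (Q := fun (_ : ℝ) (_ : M) ↦ (0 : ℝ)) hQ (T := t - s) (sub_pos.2 hst) hφ
  have hsol : IsHeatSolutionOn (fun r ↦ h (r + s)) w' 0 (t - s) := by
    refine ⟨hw', fun r hr x ↦ ?_⟩
    simpa using hw'eq r hr x
  refine ⟨fun r ↦ w' (r + -s), ?_, ?_⟩
  · have key := hsol.comp_add_const (-s)
    simp only [neg_add_cancel_right, sub_neg_eq_add, zero_add, sub_add_cancel] at key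
    exact key
  · show w' (s + -s) = φ
    rw [add_neg_cancel, hw'0]

omit [T2Space M] [SecondCountableTopology M] [MeasurableSpace M] [BorelSpace M] in
include hR in
/-- **Sup bound (maximum principle)**: a heat solution on `M × [s, t]` with `w(s, ·) ≤ A`,
`0 ≤ A`, satisfies `w ≤ A` on `M × [s, t]` (`linearHeat_le_mul_exp` with `K = 0`, `Q = 0`;
Topping 2006, Thm. 3.1.1). [cite: Topping2006, Thm. 3.1.1 (p. 35)] -/
theorem IsHeatSolutionOn.le_of_le {w : ℝ → M → ℝ} {s t : ℝ} (hst : s < t)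
    (hw : IsHeatSolutionOn h w s t) {A : ℝ} (hA : 0 ≤ A) (h0 : ∀ x, w s x ≤ A)
    {r : ℝ} (hr : r ∈ Icc s t) (x : M) : w r x ≤ A := by
  have key := hw.comp_add_const s
  simp only [sub_self] at key
  have hgR : ∀ r' ∈ Icc (0 : ℝ) (t - s), (h (r' + s)).IsRiemannian := fun r' _ ↦ hR _
  have hQ : ∀ r' ∈ Icc (0 : ℝ) (t - s), ∀ y : M, |(fun (_ : ℝ) (_ : M) ↦ (0 : ℝ)) r' y| ≤ 0 :=
    fun _ _ _ ↦ by simp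
  have hweq : ∀ r' ∈ Icc (0 : ℝ) (t - s), ∀ y : M, HasDerivWithinAt (fun r'' ↦ w (r'' + s) y)
      ((h (r' + s)).laplaceBeltrami (fun y ↦ w (r' + s) y) y
        - (fun (_ : ℝ) (_ : M) ↦ (0 : ℝ)) r' y * w (r' + s) y) (Icc 0 (t - s)) r' :=
    fun r' hr' y ↦ (key.2 r' hr' y).congr_deriv (by simp)
  have hb := linearHeat_le_mul_exp (g := fun r' ↦ h (r' + s)) (K := 0)
    (Q := fun (_ : ℝ) (_ : M) ↦ (0 : ℝ)) (T := t - s) (w := fun r' ↦ w (r' + s))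
    (sub_pos.2 hst) hgR le_rfl hQ key.1 hweq hA (fun y ↦ by simpa using h0 y)
    (s := r - s) ⟨by linarith [hr.1], by linarith [hr.2]⟩ x
  simpa using hb

omit [T2Space M] [SecondCountableTopology M] [MeasurableSpace M] [BorelSpace M] in
include hR in
/-- **Contraction in the sup norm**: two heat solutions on `M × [s, t]` with
`|w₁(s, ·) − w₂(s, ·)| ≤ A` satisfy `|w₁ − w₂| ≤ A` on `M × [s, t]`
(`linearHeat_abs_sub_le_mul_exp` with `K = 0`). [cite: Topping2006, Thm. 3.1.1 (p. 35)] -/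
theorem IsHeatSolutionOn.abs_sub_le {w₁ w₂ : ℝ → M → ℝ} {s t : ℝ} (hst : s < t)
    (hw₁ : IsHeatSolutionOn h w₁ s t) (hw₂ : IsHeatSolutionOn h w₂ s t) {A : ℝ}
    (h0 : ∀ x, |w₁ s x - w₂ s x| ≤ A) {r : ℝ} (hr : r ∈ Icc s t) (x : M) :
    |w₁ r x - w₂ r x| ≤ A := by
  have k₁ := hw₁.comp_add_const s
  have k₂ := hw₂.comp_add_const s
  simp only [sub_self] at k₁ k₂
  have hgR : ∀ r' ∈ Icc (0 : ℝ) (t - s), (h (r' + s)).IsRiemannian := fun r' _ ↦ hR _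
  have hQ : ∀ r' ∈ Icc (0 : ℝ) (t - s), ∀ y : M, |(fun (_ : ℝ) (_ : M) ↦ (0 : ℝ)) r' y| ≤ 0 :=
    fun _ _ _ ↦ by simp
  have hweq₁ : ∀ r' ∈ Icc (0 : ℝ) (t - s), ∀ y : M, HasDerivWithinAt (fun r'' ↦ w₁ (r'' + s) y)
      ((h (r' + s)).laplaceBeltrami (fun y ↦ w₁ (r' + s) y) y
        - (fun (_ : ℝ) (_ : M) ↦ (0 : ℝ)) r' y * w₁ (r' + s) y) (Icc 0 (t - s)) r' :=
    fun r' hr' y ↦ (k₁.2 r' hr' y).congr_deriv (by simp)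
  have hweq₂ : ∀ r' ∈ Icc (0 : ℝ) (t - s), ∀ y : M, HasDerivWithinAt (fun r'' ↦ w₂ (r'' + s) y)
      ((h (r' + s)).laplaceBeltrami (fun y ↦ w₂ (r' + s) y) y
        - (fun (_ : ℝ) (_ : M) ↦ (0 : ℝ)) r' y * w₂ (r' + s) y) (Icc 0 (t - s)) r' :=
    fun r' hr' y ↦ (k₂.2 r' hr' y).congr_deriv (by simp)
  have hb := linearHeat_abs_sub_le_mul_exp (g := fun r' ↦ h (r' + s)) (K := 0)
    (Q := fun (_ : ℝ) (_ : M) ↦ (0 : ℝ)) (T := t - s)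
    (w₁ := fun r' ↦ w₁ (r' + s)) (w₂ := fun r' ↦ w₂ (r' + s))
    (sub_pos.2 hst) hgR le_rfl hQ k₁.1 hweq₁ k₂.1 hweq₂ (fun y ↦ by simpa using h0 y)
    (s := r - s) ⟨by linarith [hr.1], by linarith [hr.2]⟩ x
  simpa using hb

omit [T2Space M] [SecondCountableTopology M] [MeasurableSpace M] [BorelSpace M] in
include hR in
/-- **Uniqueness** of smooth heat solutions on `M × [s, t]` with the same datum at time `s`.
[cite: Topping2006, Thm. 3.1.1 (p. 35)] -/
theorem IsHeatSolutionOn.unique {w₁ w₂ : ℝ → M → ℝ} {s t : ℝ} (hst : s < t)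
    (hw₁ : IsHeatSolutionOn h w₁ s t) (hw₂ : IsHeatSolutionOn h w₂ s t) (h0 : w₁ s = w₂ s)
    {r : ℝ} (hr : r ∈ Icc s t) (x : M) : w₁ r x = w₂ r x := by
  have hb := hw₁.abs_sub_le hR hst hw₂ (A := 0) (fun y ↦ by simp [h0]) hr x
  rw [abs_nonpos_iff, sub_eq_zero] at hb
  exact hb

omit [T2Space M] [SecondCountableTopology M] [MeasurableSpace M] [BorelSpace M] in
include hR in
/-- **Monotonicity (comparison)**: heat solutions with ordered data stay ordered. [folklore] -/
theorem IsHeatSolutionOn.le_of_le_initial {w₁ w₂ : ℝ → M → ℝ} {s t : ℝ} (hst : s < t)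
    (hw₁ : IsHeatSolutionOn h w₁ s t) (hw₂ : IsHeatSolutionOn h w₂ s t)
    (h0 : ∀ x, w₁ s x ≤ w₂ s x) {r : ℝ} (hr : r ∈ Icc s t) (x : M) : w₁ r x ≤ w₂ r x := by
  have hd : IsHeatSolutionOn h (fun r y ↦ w₁ r y + (-1) * w₂ r y) s t := hw₁.add (hw₂.const_mul (-1))
  have hb := hd.le_of_le hR hst (A := 0) le_rfl (fun y ↦ by simpa using h0 y) hr x
  simp only [neg_mul, one_mul] at hb
  linarith

end Solutions

end Literature.Geometry.Riemannian

end
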